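import Literature.MathematicalPhysics.QuantumFieldTheory.Balaban1983to89.B9SectBAllBlocksGeometryY
import Literature.MathematicalPhysics.QuantumFieldTheory.Balaban1983to89.B9GeoNbrCountKLevelV1

/-!
# `Balaban1983to89.B9GeoNbrCountBlocksY` — the NEIGHBOURHOOD COUNT `#{t ∈ 𝔅 : d(t, s) ≤ r} ≤ m_N` ON THE ALL-BLOCKS GEOMETRY `geoBK i` ∕ `geoBY x`
# (sites = ALL blocks `𝔅 = ⋃_j Λ_j` of the member's torus), member-uniform above an `M`-threshold, FROM [4] Lemma 2.1 (2.61); the constants NAMED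

T. Bałaban, *Propagators and renormalization transformations for lattice gauge theories. II*, Commun. Math. Phys. **96** (1984) 223–250
[`Balaban1984PropagatorsII`, "[4]"], Lemma 2.1 (2.61) p. 234 (*"sup_{y∈𝔅} Σ_{y′∈𝔅} e^{−αδ₀d(y,y′)} ≤ c₁(α)"* for *"RM satisfying (2.59)"*), (2.45)–(2.46)
p. 231 (`𝔅`, the distance `d(y, y′)`); T. Bałaban, *Propagators for lattice gauge theories in a background field*, Commun. Math. Phys. **99** (1985) 389–434
[`Balaban1985BackgroundPropagators`, "B9"], p. 397 (*"y, y′ ∈ 𝔅 = ⋃_j Λ_j"*, *"Δ̃(y)"*).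

statement-level skeleton of published theorems with citation tags; proofs where landed; nothing here is a claim about the Yang–Mills mass gap

THE POINT (pub-ymgap, node N06 [B9], rows 18 of the stage-11 certificate; dag-n06-c's key transfer `B9BlockKeyTransferXSK`).  The transfer «block-keyed
majorant ⟹ index-keyed majorant» ([4] (2.51) with (2.46), (2.54)) displays the count `hN : ∀ t : (geoBY x).Site, #nbr (geoBY x) 1 t ≤ N₁` of the blocks
within torus distance `1` of a block.  This file is the all-blocks twin of dag-n06-i's `B9GeoNbrCountKLevelV1` (which counts at the record geometry
`geo9K ∕ geo9Y`): the count follows from this lineage's (2.61) over ALL blocks (dag-n06-c `B9SectBAllBlocksGeometryY.rowSum_geoBK_core`, κ := 1) and the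
symmetry of `d` (`geoBK_dist_comm`) by the generic step `card_nbr_le_ceil_of_rowSum`; the constants are then NAMED by `choose` so that a certificate can
display ONE threshold `nbrM₀BY … r ≤ M⋆` and write the count `nbrCountBY … r` into its numerics.
* §1 ★ `exists_card_nbr_geoBK_le` — `∀ r, ∃ M_L mN, ∀ i, M_L ≤ M → ∀ s, #nbr (geoBK i) r s ≤ mN`.
* §2 ★ `exists_card_nbr_geoBY_le` — at def-Y's members: `∀ r, ∃ M₀ mN : ℕ, ∀ M⋆ ≥ M₀, ∀ x : MemberY … M⋆, ∀ s, #nbr (geoBY x) r s ≤ mN` (`M⋆ ≤ M = L·M_h`).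
* §3 the constants NAMED: ★ `nbrM₀BY … r`, ★ `nbrCountBY … r`, ★ `card_nbr_geoBY_le_of_le`, ★★ `hnbrBY_of_le` (family-instance shape), `hnbrBY_real_of_le` (the
  real-cast shape `((nbr (geoBY x) r t).card : ℝ) ≤ nbrCountBY … r` the key transfer reads).

HONEST SCOPE.  A corollary of the tree's (2.61) over all blocks with its GENERIC constant and its `M`-threshold ((2.59) *"RM sufficiently large"*); the
count depends on `d, ℓ, b₀, b₁, r` only but is asserted only above the threshold; the threshold-free combinatorial count is NOT claimed.  Nothing of [B9]'s
estimates is asserted; count-neutral supply for the N06 knit; N06 NOT discharged; one finite lattice programme — nothing continuum, nothing about the mass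
gap.  Cell `pub-ymgap` (HUMAN RULING D-0062), Track A node N06 [B9], seat `pub-ymgap-dag-n06-d` (gen 23), 2026-08-30.  Net new unproved facts: 0.  NEW file.
-/

noncomputable section

namespace Literature.MathematicalPhysics.QuantumFieldTheory.Balaban1983to89.B9GeoNbrCountBlocksY

open B6KLevelCensusIndexV1 (KIdx)
open B9PinMembersKLevelV1 (MemberY geo9Y mstar_le_M)
open B9SectBAllBlocksGeometryY (geoBK geoBY rowSum_geoBK_core geoBK_dist_comm)
open B9GeoNbrCountKLevelV1 (card_nbr_le_ceil_of_rowSum)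
open B9RWSumsReadsNbr (nbr)

variable {d ℓ : ℕ} {hd : 1 ≤ d + 1} {hL : Odd (ℓ + 1) ∧ 1 < ℓ + 1} {b₀ b₁ : ℝ}

/-! ## §1 On all blocks of a k-level V1 index: the count above the (2.59) threshold, from (2.61) at rate 1 -/

section Index

/-- ★ **THE NEIGHBOURHOOD COUNT ON `geoBK`, ABOVE AN `M`-THRESHOLD**: for every radius `r` there are `M_L` and `mN` such that every k-level V1 index with
`M_L ≤ M` has `#{t ∈ 𝔅 : d(t, s) ≤ r} ≤ mN` at every block `s` — (2.61) over all blocks at rate κ = 1 (`rowSum_geoBK_core`) and the symmetry of (2.46)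
(`geoBK_dist_comm`); `mN = ⌈c·e^{r}⌉₊` with (2.61)'s generic constant c (any `Fintype` instance on the blocks).
[cite: Balaban1984PropagatorsII, Lemma 2.1 (2.61) p.234 + (2.59) p.233, (2.46) p.231] -/
theorem exists_card_nbr_geoBK_le (r : ℝ) :
    ∃ ML : ℝ, ∃ mN : ℕ, ∀ (i : KIdx d ℓ hd hL b₀ b₁) [Fintype (geoBK i).Site], ML ≤ (geoBK i).M →
      ∀ s : (geoBK i).Site, (nbr (geoBK i) r s).card ≤ mN := by
  obtain ⟨ML, C, h⟩ := rowSum_geoBK_core (d := d) (ℓ := ℓ) (hd := hd) (hL := hL) (b₀ := b₀) (b₁ := b₁) (κ := 1) one_pos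
  refine ⟨ML, ⌈C * Real.exp (1 * r)⌉₊, fun i inst hM s => ?_⟩
  exact card_nbr_le_ceil_of_rowSum zero_le_one (geoBK_dist_comm i) (@h i inst hM s)

end Index

/-! ## §2 At def-Y's members `geoBY x`: the count above an `M⋆`-threshold -/

section Members

variable {Mstar : ℕ}

/-- `(geoBY x).M = (geo9Y x).M` (`= L·M_h`: every site-free field of the all-blocks geometry is that of the geometry of record).
[cite: Balaban1984PropagatorsII, (2.1) p.224, dictionary] -/
theorem geoBY_M_eq (x : MemberY d ℓ hd hL b₀ b₁ Mstar) : (geoBY x).M = (geo9Y x).M := rfl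

/-- the absolute floor at a member, all-blocks currency: `M⋆ ≤ (geoBY x).M`. [cite: Balaban1985BackgroundPropagators, p.426 («M and R sufficiently large»), bookkeeping] -/
theorem mstar_le_geoBY_M (x : MemberY d ℓ hd hL b₀ b₁ Mstar) : (Mstar : ℝ) ≤ (geoBY x).M := by
  rw [geoBY_M_eq]; exact mstar_le_M x

end Members

/-- ★ **THE NEIGHBOURHOOD COUNT ON THE MEMBERS' BLOCKS, UNIFORM ABOVE AN `M⋆`-THRESHOLD**: for every radius `r` there are `M₀, mN : ℕ` such that for every
`M⋆ ≥ M₀`, every member `x : MemberY … M⋆` and every block `s`, `#{t ∈ 𝔅 : d(t, s) ≤ r} ≤ mN` (a member has `M⋆ ≤ M = L·M_h`).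
[cite: Balaban1984PropagatorsII, Lemma 2.1 (2.61) p.234 + (2.59) p.233; Balaban1985BackgroundPropagators, p.397 (𝔅, Δ̃(y))] -/
theorem exists_card_nbr_geoBY_le (r : ℝ) :
    ∃ M₀ mN : ℕ, ∀ (Mstar : ℕ), M₀ ≤ Mstar →
      ∀ (x : MemberY d ℓ hd hL b₀ b₁ Mstar) [Fintype (geoBY x).Site] (s : (geoBY x).Site), (nbr (geoBY x) r s).card ≤ mN := by
  obtain ⟨ML, mN, h⟩ := exists_card_nbr_geoBK_le (d := d) (ℓ := ℓ) (hd := hd) (hL := hL) (b₀ := b₀) (b₁ := b₁) r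
  refine ⟨⌈ML⌉₊, mN, fun Mstar hM x inst s => @h x.toKIdx inst ?_ s⟩
  calc ML ≤ (⌈ML⌉₊ : ℝ) := Nat.le_ceil _
    _ ≤ (Mstar : ℝ) := by exact_mod_cast hM
    _ ≤ (geoBY x).M := mstar_le_geoBY_M x

/-- the same with the threshold read on the member's own `M = L·M_h`: `∃ M_L mN, ∀ M⋆ x, M_L ≤ (geoBY x).M → ∀ s, #nbr (geoBY x) r s ≤ mN`.
[cite: Balaban1984PropagatorsII, Lemma 2.1 (2.61) p.234 + (2.59) p.233, bookkeeping] -/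
theorem exists_card_nbr_geoBY_le_of_M (r : ℝ) :
    ∃ ML : ℝ, ∃ mN : ℕ, ∀ (Mstar : ℕ) (x : MemberY d ℓ hd hL b₀ b₁ Mstar) [Fintype (geoBY x).Site], ML ≤ (geoBY x).M →
      ∀ s : (geoBY x).Site, (nbr (geoBY x) r s).card ≤ mN := by
  obtain ⟨ML, mN, h⟩ := exists_card_nbr_geoBK_le (d := d) (ℓ := ℓ) (hd := hd) (hL := hL) (b₀ := b₀) (b₁ := b₁) r
  exact ⟨ML, mN, fun _ x inst hM s => @h x.toKIdx inst hM s⟩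

/-! ## §3 Named constants (a certificate displays ONE threshold and names the count in its numerics) -/

section Named

variable (d ℓ : ℕ) (hd : 1 ≤ d + 1) (hL : Odd (ℓ + 1) ∧ 1 < ℓ + 1) (b₀ b₁ : ℝ)

/-- ★ **THE `M⋆`-THRESHOLD OF THE ALL-BLOCKS NEIGHBOURHOOD COUNT AT RADIUS `r`, NAMED**: `nbrM₀BY d ℓ hd hL b₀ b₁ r : ℕ` (the first witness of
`exists_card_nbr_geoBY_le r`, by `choose` — opaque; a function of `d, ℓ, b₀, b₁, r` only). [cite: Balaban1984PropagatorsII, (2.59) p.233 («RM sufficiently large»), bookkeeping] -/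
def nbrM₀BY (r : ℝ) : ℕ :=
  (exists_card_nbr_geoBY_le (d := d) (ℓ := ℓ) (hd := hd) (hL := hL) (b₀ := b₀) (b₁ := b₁) r).choose

/-- ★ **THE ALL-BLOCKS NEIGHBOURHOOD COUNT AT RADIUS `r`, NAMED**: `nbrCountBY d ℓ hd hL b₀ b₁ r : ℕ` — a member-uniform bound on `#{t ∈ 𝔅 : d(t, s) ≤ r}` above
the threshold `nbrM₀BY … r ≤ M⋆` (the second witness of `exists_card_nbr_geoBY_le r`, by `choose` — opaque; only `card_nbr_geoBY_le_of_le` is to be used).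
[cite: Balaban1984PropagatorsII, Lemma 2.1 (2.61) p.234; Balaban1985BackgroundPropagators, p.397 (𝔅, Δ̃(y)), bookkeeping] -/
def nbrCountBY (r : ℝ) : ℕ :=
  (exists_card_nbr_geoBY_le (d := d) (ℓ := ℓ) (hd := hd) (hL := hL) (b₀ := b₀) (b₁ := b₁) r).choose_spec.choose

variable {d ℓ hd hL b₀ b₁}

/-- ★ **THE COUNT WITH THE NAMED CONSTANTS**: `nbrM₀BY … r ≤ M⋆ ⇒ ∀ x s, #nbr (geoBY x) r s ≤ nbrCountBY … r` (any `Fintype` instance on the blocks).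
[cite: Balaban1984PropagatorsII, Lemma 2.1 (2.61) p.234 + (2.59) p.233] -/
theorem card_nbr_geoBY_le_of_le {r : ℝ} {Mstar : ℕ} (hM : nbrM₀BY d ℓ hd hL b₀ b₁ r ≤ Mstar)
    (x : MemberY d ℓ hd hL b₀ b₁ Mstar) [Fintype (geoBY x).Site] (s : (geoBY x).Site) :
    (nbr (geoBY x) r s).card ≤ nbrCountBY d ℓ hd hL b₀ b₁ r :=
  (exists_card_nbr_geoBY_le (d := d) (ℓ := ℓ) (hd := hd) (hL := hL) (b₀ := b₀) (b₁ := b₁) r).choose_spec.choose_spec Mstar hM x s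

/-- ★★ **THE KEY TRANSFER'S BINDER `hN`, FROM ONE DISPLAYED THRESHOLD** (family-instance shape): `nbrM₀BY … r ≤ M⋆ ⇒ ∀ x t, #nbr (geoBY x) r t ≤ nbrCountBY … r`.
[cite: Balaban1984PropagatorsII, Lemma 2.1 (2.61) p.234 + (2.59) p.233; Balaban1985BackgroundPropagators, p.397 (𝔅, Δ̃(y))] -/
theorem hnbrBY_of_le {r : ℝ} {Mstar : ℕ} (hM : nbrM₀BY d ℓ hd hL b₀ b₁ r ≤ Mstar)
    [∀ x : MemberY d ℓ hd hL b₀ b₁ Mstar, Fintype (geoBY x).Site] :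
    ∀ (x : MemberY d ℓ hd hL b₀ b₁ Mstar) (t : (geoBY x).Site), (nbr (geoBY x) r t).card ≤ nbrCountBY d ℓ hd hL b₀ b₁ r :=
  fun x t => card_nbr_geoBY_le_of_le hM x t

/-- the same in the real-cast shape `((nbr (geoBY x) r t).card : ℝ) ≤ (nbrCountBY … r : ℝ)` (the shape dag-n06-c's `hasMajorant_blkSK_of_blkOfSK` ∕
`local342_opsWalkY_of_blocks` display). [cite: Balaban1984PropagatorsII, Lemma 2.1 (2.61) p.234 + (2.59) p.233, bookkeeping] -/
theorem hnbrBY_real_of_le {r : ℝ} {Mstar : ℕ} (hM : nbrM₀BY d ℓ hd hL b₀ b₁ r ≤ Mstar)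
    (x : MemberY d ℓ hd hL b₀ b₁ Mstar) [Fintype (geoBY x).Site] (t : (geoBY x).Site) :
    ((nbr (geoBY x) r t).card : ℝ) ≤ (nbrCountBY d ℓ hd hL b₀ b₁ r : ℝ) := by
  exact_mod_cast card_nbr_geoBY_le_of_le hM x t

end Named

end Literature.MathematicalPhysics.QuantumFieldTheory.Balaban1983to89.B9GeoNbrCountBlocksY

end
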